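import Summits.QuantumFields.GaugeBoot.HankelDominance
import HarnessLib

/-!
# Hankel dominance under a geometric bound ("capped root trick"): `|h₁| ≤ λ · h₀`

Cell `ym-instrument` (HUMAN RULING D-0084 (2); director-ym R138; HOME `run/shared/lean/pub/ym-instrument/`), crew (a),
Lean typist seat `ym-instrument-boot-lean-1` (gen 3). Question Q-A1, amendment A-plan-11 «BESSEL CAP», the class-LIMIT
COROLLARY `supp μ_R ⊂ [0, λ_R]` (boot-plan AMEND A-plan-10 §1 / A-plan-11 v2 §1 (B2); boot-ref LIMIT-SOUNDNESS P.5):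
this module is its FINITE CONTENT in pure form, the companion of `GaugeBoot/HankelDominance` (Lemma HD, the root trick).

HONEST FRAMING (page 1 of every file of this cell): THIS MODULE IS PURE MATHEMATICS (Mathlib + `HankelDominance` only);
nothing in it refers to lattice gauge theory, nothing is certified about any `(G, D, L, β)`, nothing is summit-bearing.
Intended use (file `YangMills/Theorems/Instrument/BesselCapLimitHankel`): `f t := ∫ W̄(t × m) dμ` at an infinite-volume
limit point along even tori, with the typed Bessel cap `|f t| ≤ λ_m^t` (`Instrument/BesselCapLimit`, `…/BesselCapWidthOne`).

## Content (Berg–Christensen–Ressel 1984, Ch. 4 Prop. 1.12, rescaled)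

If `f : ℕ → ℝ` has every finite Hankel form positive semidefinite, `0 ≤ Σ_{a,b∈S} c_a c_b f(a+b)`, and obeys a
GEOMETRIC bound `|f t| ≤ C · λ^t` (`λ > 0`), then the shifted form is dominated by `λ` times the unshifted one:
`|Σ c_a c_b f(a+b+1)| ≤ λ · Σ c_a c_b f(a+b)` (`abs_hankel_shift_le_mul`). Mechanism: `g t := f t / (C λ^t)` is bounded
by `1` and again Hankel-positive (`hankel_nonneg_mul_pow`: rescaling `c_a ↦ c_a s^a`), so Lemma HD
(`Hankel.abs_hankel_shift_le`) applies to `g` with coefficients `c_a λ^a`; undoing the rescaling gives the factor `λ`.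
Corollaries: the CAPPED difference-Hankel blocks `[λ f(a+b) − f(a+b+1)]_{a,b∈S} ⪰ 0` (`hankel_cap_sub_shift_nonneg`, site
type) and `[λ f(a+b+1) − f(a+b+2)]_{a,b∈S} ⪰ 0` (`hankel_cap_sub_shift_nonneg_succ`, link type, from the shifted Hankel
family), and the capped monotonicity `f(t+1) ≤ λ f(t)` for every `t` (`succ_le_mul_of_hankel_cap`, the `1 × 1` blocks of
both types). With a moment representation `f t = ∫ x^t dν` these say `supp ν ⊂ [−λ, λ]` resp. `⊂ [0, λ]`; the representation
is NOT formalised (as in `HankelDominance` / `WilsonLoopLimitMonotone`), only its finite content.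
-/

namespace Summit.QuantumFields.GaugeBoot.Hankel

open Finset

/-- Rescaling the coefficients: Hankel positivity of `f` gives Hankel positivity of `t ↦ s^t f t` for every real `s`
(`s^{a+b} = s^a s^b`). [folklore] -/
theorem hankel_nonneg_mul_pow (f : ℕ → ℝ) (s : ℝ)
    (hp : ∀ (S : Finset ℕ) (c : ℕ → ℝ), 0 ≤ ∑ a ∈ S, ∑ b ∈ S, c a * c b * f (a + b))
    (S : Finset ℕ) (c : ℕ → ℝ) :
    0 ≤ ∑ a ∈ S, ∑ b ∈ S, c a * c b * (s ^ (a + b) * f (a + b)) := by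
  have h := hp S (fun a => c a * s ^ a)
  have e : ∑ a ∈ S, ∑ b ∈ S, c a * c b * (s ^ (a + b) * f (a + b))
      = ∑ a ∈ S, ∑ b ∈ S, (c a * s ^ a) * (c b * s ^ b) * f (a + b) :=
    sum_congr rfl fun a _ => sum_congr rfl fun b _ => by rw [pow_add]; ring
  rw [e]; exact h

/-- **Capped root trick** (Berg–Christensen–Ressel 1984, Ch. 4 Prop. 1.12, rescaled form): if `0 < λ`, `|f t| ≤ C λ^t`
for every `t` and every finite Hankel form of `f` is non-negative, then
`|Σ_{a,b∈S} c_a c_b f(a+b+1)| ≤ λ · Σ_{a,b∈S} c_a c_b f(a+b)`. [folklore] -/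
theorem abs_hankel_shift_le_mul (f : ℕ → ℝ) {q C : ℝ} (hq : 0 < q) (hb : ∀ t, |f t| ≤ C * q ^ t)
    (hp : ∀ (S : Finset ℕ) (c : ℕ → ℝ), 0 ≤ ∑ a ∈ S, ∑ b ∈ S, c a * c b * f (a + b))
    (S : Finset ℕ) (c : ℕ → ℝ) :
    |∑ a ∈ S, ∑ b ∈ S, c a * c b * f (a + b + 1)| ≤ q * ∑ a ∈ S, ∑ b ∈ S, c a * c b * f (a + b) := by
  have hC : 0 ≤ C := by
    have h := (abs_nonneg (f 0)).trans (hb 0)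
    simpa using h
  rcases hC.eq_or_lt with hC0 | hCpos
  · -- `C = 0`: the sequence vanishes identically
    have hf : ∀ t, f t = 0 := fun t =>
      abs_eq_zero.1 (le_antisymm ((hb t).trans (by rw [← hC0, zero_mul])) (abs_nonneg _))
    simp [hf]
  -- normalised sequence `g t = f t / (C q^t)`: bounded by `1`, Hankel-positive
  set g : ℕ → ℝ := fun t => f t / (C * q ^ t) with hg
  have hgb : ∀ t, |g t| ≤ 1 := fun t => by
    have hpos : 0 < C * q ^ t := mul_pos hCpos (pow_pos hq t)
    show |f t / (C * q ^ t)| ≤ 1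
    rw [abs_div, abs_of_pos hpos, div_le_one hpos]
    exact hb t
  have hgp : ∀ (S : Finset ℕ) (c : ℕ → ℝ), 0 ≤ ∑ a ∈ S, ∑ b ∈ S, c a * c b * g (a + b) := by
    intro S c
    have h := hankel_nonneg_mul_pow f q⁻¹ hp S c
    have e : ∑ a ∈ S, ∑ b ∈ S, c a * c b * g (a + b) =
        C⁻¹ * ∑ a ∈ S, ∑ b ∈ S, c a * c b * ((q⁻¹) ^ (a + b) * f (a + b)) := by
      rw [mul_sum]; refine sum_congr rfl fun a _ => ?_
      rw [mul_sum]; refine sum_congr rfl fun b _ => ?_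
      show c a * c b * (f (a + b) / (C * q ^ (a + b))) = _
      rw [inv_pow, div_eq_mul_inv, mul_inv]
      ring
    rw [e]; exact mul_nonneg (inv_nonneg.2 hC) h
  have key := abs_hankel_shift_le g hgb hgp S (fun a => c a * q ^ a)
  have hq0 : q ≠ 0 := hq.ne'
  have hC0 : C ≠ 0 := hCpos.ne'
  have e1 : ∑ a ∈ S, ∑ b ∈ S, (c a * q ^ a) * (c b * q ^ b) * g (a + b + 1) =
      (C * q)⁻¹ * ∑ a ∈ S, ∑ b ∈ S, c a * c b * f (a + b + 1) := by
    rw [mul_sum]; refine sum_congr rfl fun a _ => ?_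
    rw [mul_sum]; refine sum_congr rfl fun b _ => ?_
    show c a * q ^ a * (c b * q ^ b) * (f (a + b + 1) / (C * q ^ (a + b + 1))) = _
    have hqa : q ^ a ≠ 0 := pow_ne_zero _ hq0
    have hqb : q ^ b ≠ 0 := pow_ne_zero _ hq0
    rw [pow_succ, pow_add]
    field_simp
  have e2 : ∑ a ∈ S, ∑ b ∈ S, (c a * q ^ a) * (c b * q ^ b) * g (a + b) =
      C⁻¹ * ∑ a ∈ S, ∑ b ∈ S, c a * c b * f (a + b) := by
    rw [mul_sum]; refine sum_congr rfl fun a _ => ?_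
    rw [mul_sum]; refine sum_congr rfl fun b _ => ?_
    show c a * q ^ a * (c b * q ^ b) * (f (a + b) / (C * q ^ (a + b))) = _
    have hqa : q ^ a ≠ 0 := pow_ne_zero _ hq0
    have hqb : q ^ b ≠ 0 := pow_ne_zero _ hq0
    rw [pow_add]
    field_simp
  have hCq : 0 < C * q := mul_pos hCpos hq
  rw [e1, e2, abs_mul, abs_of_pos (inv_pos.2 hCq)] at key
  have key' := (inv_mul_le_iff₀ hCq).1 key
  calc |∑ a ∈ S, ∑ b ∈ S, c a * c b * f (a + b + 1)|
      ≤ C * q * (C⁻¹ * ∑ a ∈ S, ∑ b ∈ S, c a * c b * f (a + b)) := key'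
    _ = q * ∑ a ∈ S, ∑ b ∈ S, c a * c b * f (a + b) := by
        rw [mul_comm C q, mul_assoc, mul_inv_cancel_left₀ hC0]

/-- **Capped difference-Hankel block, site type**: `[λ f(a+b) − f(a+b+1)]_{a,b∈S} ⪰ 0` under the hypotheses of
`abs_hankel_shift_le_mul`. [folklore] -/
theorem hankel_cap_sub_shift_nonneg (f : ℕ → ℝ) {q C : ℝ} (hq : 0 < q) (hb : ∀ t, |f t| ≤ C * q ^ t)
    (hp : ∀ (S : Finset ℕ) (c : ℕ → ℝ), 0 ≤ ∑ a ∈ S, ∑ b ∈ S, c a * c b * f (a + b))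
    (S : Finset ℕ) (c : ℕ → ℝ) :
    0 ≤ ∑ a ∈ S, ∑ b ∈ S, c a * c b * (q * f (a + b) - f (a + b + 1)) := by
  have h := (abs_le.1 (abs_hankel_shift_le_mul f hq hb hp S c)).2
  have e : ∑ a ∈ S, ∑ b ∈ S, c a * c b * (q * f (a + b) - f (a + b + 1))
      = q * (∑ a ∈ S, ∑ b ∈ S, c a * c b * f (a + b)) - ∑ a ∈ S, ∑ b ∈ S, c a * c b * f (a + b + 1) := by
    simp only [mul_sub, sum_sub_distrib, mul_sum]
    refine congrArg₂ _ (sum_congr rfl fun a _ => sum_congr rfl fun b _ => by ring) rfl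
  rw [e]; linarith

/-- **Capped difference-Hankel block, link type**: if the SHIFTED Hankel forms `Σ c_a c_b f(a+b+1)` are non-negative and
`|f t| ≤ C λ^t`, then `[λ f(a+b+1) − f(a+b+2)]_{a,b∈S} ⪰ 0` (the lemma applied to `t ↦ f (t+1)`, whose bound is
`(C λ) λ^t`). [folklore] -/
theorem hankel_cap_sub_shift_nonneg_succ (f : ℕ → ℝ) {q C : ℝ} (hq : 0 < q) (hb : ∀ t, |f t| ≤ C * q ^ t)
    (hl : ∀ (S : Finset ℕ) (c : ℕ → ℝ), 0 ≤ ∑ a ∈ S, ∑ b ∈ S, c a * c b * f (a + b + 1))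
    (S : Finset ℕ) (c : ℕ → ℝ) :
    0 ≤ ∑ a ∈ S, ∑ b ∈ S, c a * c b * (q * f (a + b + 1) - f (a + b + 2)) :=
  hankel_cap_sub_shift_nonneg (fun t => f (t + 1)) hq
    (fun t => by
      have h := hb (t + 1)
      rw [pow_succ] at h
      calc |f (t + 1)| ≤ C * (q ^ t * q) := h
        _ = C * q * q ^ t := by ring)
    hl S c

/-- **Capped monotonicity** `f(t+1) ≤ λ f(t)` for EVERY `t`, from the `1 × 1` capped blocks of both types: even `t = 2a`
from the site family (`S = {a}`), odd `t = 2a+1` from the link family. [folklore] -/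
theorem succ_le_mul_of_hankel_cap (f : ℕ → ℝ) {q C : ℝ} (hq : 0 < q) (hb : ∀ t, |f t| ≤ C * q ^ t)
    (hp : ∀ (S : Finset ℕ) (c : ℕ → ℝ), 0 ≤ ∑ a ∈ S, ∑ b ∈ S, c a * c b * f (a + b))
    (hl : ∀ (S : Finset ℕ) (c : ℕ → ℝ), 0 ≤ ∑ a ∈ S, ∑ b ∈ S, c a * c b * f (a + b + 1)) (t : ℕ) :
    f (t + 1) ≤ q * f t := by
  rcases Nat.even_or_odd t with ⟨a, rfl⟩ | ⟨a, rfl⟩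
  · have h := hankel_cap_sub_shift_nonneg f hq hb hp {a} (fun _ => 1)
    simp only [sum_singleton, one_mul] at h
    linarith
  · have h := hankel_cap_sub_shift_nonneg_succ f hq hb hl {a} (fun _ => 1)
    simp only [sum_singleton, one_mul] at h
    have e1 : a + a + 1 = 2 * a + 1 := by ring
    have e2 : a + a + 2 = 2 * a + 1 + 1 := by ring
    rw [e1, e2] at h
    linarith

end Summit.QuantumFields.GaugeBoot.Hankel
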